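import Mathlib
import Summits.ValiantsHypothesis.ValiantsHypothesis.Theorems.AlgebraicKWGamesHistoryAlternationRun

/-!
# History-dependent algebraic KW protocols: blocks along the generic run and one adversary round

Support lemmas for the crux `stmt-ValiantsHypothesis-10298` (`…Theses.AlgebraicKWGames.KWPerLowerBound`,
filed `--supports`), continuing `…AlgebraicKWGamesHistoryAlternationRun`.

For an `HProtocol` `P` (history-dependent speaker `owner`) and an identified set `E`, the BLOCK INDEX of
round `t` along the generic run on `E` is `P.hblk E t = off + #{s < t : gOwner E s ≠ gOwner E (s+1)}`
(number of alternations so far, shifted by `off ∈ {0,1}` so that Alice speaks exactly in the even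
blocks: `gOwner E t = Even (hblk E t)`); it is monotone in `t` and — by the specialisation lemma — the
blocks of `E` and of `insert e E` agree up to the first killed round.  With `Pref E v` = the generic
messages (rounds `< T`) of the blocks `< v` and the two measures `rk (Xall ∪ Pref E v)`,
`rk (BE E ∪ Pref E v)` of `…BoundedAlternationLowerBoundPotential`, the main result `HProtocol.round` is
verbatim the oblivious one: one adversary round from `E` (two cells to spare) yields a new cell
`e = genOut E ∉ E` and the block index `v₀` of the first killed round such that, with `E' = insert e E`,
both measures weakly decrease for every `v ≤ v₀` and the measure of the speaker of block `v₀` strictly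
decreases at `v₀`.

Honest framing: bookkeeping for a toy-model lower bound (bounded alternation, history-dependent
schedule); the crux itself is NOT proved here and nothing in this file bears on VP versus VNP.
-/

open MvPolynomial

-- the summit and the problem share the name `ValiantsHypothesis` (D-0017 single-conjunct layout)
set_option linter.dupNamespace false

namespace Summit.ValiantsHypothesis.ValiantsHypothesis.Theorems.AlgebraicKWGames.OneAlt

open scoped Classical

noncomputable section

variable {n T : ℕ} {f : MvPolynomial (Cell n) ℂ} (P : HProtocol n T f)

namespace HProtocol

/-! ## Blocks along the generic run -/

/-- The block offset: `0` if Alice opens the protocol, `1` if Bob does (round `0` has no history). -/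
def off : ℕ := if P.owner 0 (fun j : Fin 0 => j.elim0) then 0 else 1

/-- The offset is `0` or `1`. -/
theorem off_le_one : P.off ≤ 1 := by
  unfold off; split_ifs <;> simp

/-- The block index of round `t` along the generic run on `E`: the offset plus the number of speaker
alternations among the rounds `0, …, t`. -/
def hblk (E : Finset (Cell n)) (t : ℕ) : ℕ :=
  P.off + ((Finset.range t).filter (fun s => P.gOwner E s ≠ P.gOwner E (s + 1))).card

/-- One more round adds one to the block index exactly at an alternation. -/
theorem hblk_succ (E : Finset (Cell n)) (t : ℕ) :
    P.hblk E (t + 1) = P.hblk E t + (if P.gOwner E t ≠ P.gOwner E (t + 1) then 1 else 0) := by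
  unfold hblk
  rw [Finset.range_add_one, Finset.filter_insert]
  split_ifs with h
  · rw [Finset.card_insert_of_notMem (by simp)]
    ring
  · simp

/-- The block index is monotone in the round. -/
theorem hblk_mono (E : Finset (Cell n)) : Monotone (P.hblk E) := by
  refine monotone_nat_of_le_succ fun t => ?_
  rw [hblk_succ]
  exact Nat.le_add_right _ _

/-- The generic speaker of round `0` is the opener. -/
theorem gOwner_zero (E : Finset (Cell n)) : P.gOwner E 0 = P.owner 0 (fun j : Fin 0 => j.elim0) := by
  unfold gOwner
  congr 1
  funext j
  exact j.elim0

/-- **Alice speaks in the even blocks**: the generic speaker of round `t` is Alice iff the block index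
of round `t` is even. -/
theorem gOwner_eq_decide_even (E : Finset (Cell n)) :
    ∀ t, P.gOwner E t = decide (Even (P.hblk E t)) := by
  intro t
  induction t with
  | zero =>
    have h0 : P.hblk E 0 = P.off := by simp [hblk]
    rw [h0, gOwner_zero]
    unfold off
    cases P.owner 0 (fun j : Fin 0 => j.elim0) <;> simp
  | succ t ih =>
    rw [hblk_succ]
    by_cases h : P.gOwner E t ≠ P.gOwner E (t + 1)
    · rw [if_pos h]
      have h' : P.gOwner E (t + 1) = !P.gOwner E t := by
        cases h1 : P.gOwner E t <;> cases h2 : P.gOwner E (t + 1) <;> simp_all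
      rw [h', ih]
      by_cases he : Even (P.hblk E t)
      · have hne : ¬ Even (P.hblk E t + 1) := by rwa [Nat.even_add_one, not_not]
        simp [he, hne]
      · have hne : Even (P.hblk E t + 1) := by rwa [Nat.even_add_one]
        simp [he, hne]
    · rw [if_neg h, add_zero]
      push Not at h
      rw [← h, ih]

/-- Rounds with the same block index have the same generic speaker. -/
theorem gOwner_eq_of_hblk_eq (E : Finset (Cell n)) {j t : ℕ} (h : P.hblk E j = P.hblk E t) :
    P.gOwner E j = P.gOwner E t := by
  rw [gOwner_eq_decide_even, gOwner_eq_decide_even, h]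

/-- Rounds of earlier blocks come earlier. -/
theorem lt_of_hblk_lt (E : Finset (Cell n)) {j t : ℕ} (h : P.hblk E j < P.hblk E t) : j < t := by
  by_contra hle
  exact absurd (P.hblk_mono E (not_lt.mp hle)) (not_le.mpr h)

set_option maxHeartbeats 400000 in
/-- **Blocks are local.**  If the generic speakers on `E` and on `F` agree up to round `t`, then so do
the block indices. -/
theorem hblk_eq_of_gOwner_eq {E F : Finset (Cell n)} {t : ℕ} (h : ∀ j ≤ t, P.gOwner F j = P.gOwner E j) :
    P.hblk F t = P.hblk E t := by
  unfold hblk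
  congr 2
  refine Finset.filter_congr fun s hs => ?_
  have hst : s < t := Finset.mem_range.mp hs
  rw [h s hst.le, h (s + 1) hst]

/-- A bound on the alternations along every zero pattern bounds the block indices of the rounds `< T`
along every generic run (by `Δ + 1`, absorbing the offset). -/
theorem hblk_le_of_altBound {Δ : ℕ}
    (hΔ : ∀ z : ℕ → Bool, ((Finset.range (T - 1)).filter (fun s =>
      P.owner s (fun j : Fin s => z j) ≠ P.owner (s + 1) (fun j : Fin (s + 1) => z j))).card ≤ Δ)
    (E : Finset (Cell n)) {t : ℕ} (ht : t < T) : P.hblk E t ≤ Δ + 1 := by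
  have h1 := hΔ (fun j => P.genPat E j)
  have h2 : ((Finset.range t).filter (fun s => P.gOwner E s ≠ P.gOwner E (s + 1))).card ≤
      ((Finset.range (T - 1)).filter (fun s => P.owner s (fun j : Fin s => P.genPat E j) ≠
        P.owner (s + 1) (fun j : Fin (s + 1) => P.genPat E j))).card := by
    apply Finset.card_le_card
    intro s hs
    simp only [Finset.mem_filter, Finset.mem_range] at hs ⊢
    exact ⟨by omega, hs.2⟩
  have h3 := P.off_le_one
  unfold hblk
  omega

/-! ## Prefixes and the two measures -/

/-- After identification on `E`, the speaker's variables of round `t` are the `E`-inputs of its block. -/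
theorem range_subst_svars (E : Finset (Cell n)) (t : ℕ) :
    Set.range (fun c => subst E (svars (P.gOwner E t) c)) = base E (P.hblk E t) := by
  rw [gOwner_eq_decide_even]
  unfold base svars
  by_cases h : Even (P.hblk E t)
  · simp only [h, decide_true, if_pos, subst_X_inl]; rfl
  · simp only [h, decide_false, if_neg, not_false_eq_true]; rfl

/-- The generic messages (rounds `< T`) of the blocks `< v` on the subspace `E`. -/
def Pref (E : Finset (Cell n)) (v : ℕ) : Set (R n) :=
  (fun j => P.gen E j) '' {j | j < T ∧ P.hblk E j < v}

/-- A speaker's inputs together with a prefix: at most `n² + T` polynomials (a prefix has at most `T`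
messages). -/
theorem encard_base_union_Pref_le (E : Finset (Cell n)) (v w : ℕ) :
    (base E w ∪ P.Pref E v).encard ≤ ((Fintype.card (Cell n) + T : ℕ) : ℕ∞) := by
  refine (Set.encard_union_le _ _).trans ?_
  rw [encard_base, Nat.cast_add]
  refine add_le_add le_rfl ?_
  refine (Set.encard_image_le _ _).trans ?_
  have h : ({j | j < T ∧ P.hblk E j < v} : Set ℕ) ⊆ (↑(Finset.range T) : Set ℕ) := by
    intro j hj; simpa using hj.1
  refine (Set.encard_le_encard h).trans ?_
  rw [Set.encard_coe_eq_coe_finsetCard, Finset.card_range]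

/-- Each generic message is a polynomial in the speaker's `E`-inputs and the earlier messages. -/
theorem gen_mem_adjoin_round (E : Finset (Cell n)) (t : ℕ) :
    P.gen E t ∈ Algebra.adjoin ℂ (base E (P.hblk E t) ∪ (fun j => P.gen E j) '' Set.Iio t) := by
  have h := P.subst_gen_eq_aeval (subset_rfl (a := E)) t
  rw [P.subst_gen_of_subset subset_rfl] at h
  rw [h]
  refine (Algebra.adjoin_le ?_) (aeval_mem_adjoin_range _ _)
  rintro _ ⟨i, rfl⟩
  rcases i with c | j
  · refine Algebra.subset_adjoin (Or.inl ?_)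
    rw [← range_subst_svars]; exact ⟨c, rfl⟩
  · refine Algebra.subset_adjoin (Or.inr ⟨j, j.2, ?_⟩)
    simp only [Sum.elim_inr, P.subst_gen_of_subset subset_rfl]

/-- Within a block, messages are absorbed: every generic message of a round `t < T` lies in the closure of
the speaker's inputs and the prefix of the earlier blocks. -/
theorem gen_mem_closure (E : Finset (Cell n)) :
    ∀ t < T, P.gen E t ∈ (Mat n).closure (base E (P.hblk E t) ∪ P.Pref E (P.hblk E t)) := by
  intro t
  induction t using Nat.strong_induction_on with
  | _ t ih =>
    intro htT
    apply adjoin_subset_closure ?_ (P.gen_mem_adjoin_round E t)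
    rintro q (hq | ⟨j, hj, rfl⟩)
    · exact (Mat n).subset_closure _ (by simp) (Or.inl hq)
    · have hjt : j < t := hj
      rcases (P.hblk_mono E hjt.le).lt_or_eq with hlt | heq
      · exact (Mat n).subset_closure _ (by simp) (Or.inr ⟨j, ⟨lt_trans hjt htT, hlt⟩, rfl⟩)
      · have := ih j hjt (lt_trans hjt htT)
        rwa [heq] at this

/-- All earlier messages of a round `t₀ < T` lie in the closure of the speaker's inputs of block
`hblk E t₀` and the prefix of the earlier blocks. -/
theorem image_Iio_subset_closure (E : Finset (Cell n)) {t₀ : ℕ} (ht₀ : t₀ < T) :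
    base E (P.hblk E t₀) ∪ (fun j => P.gen E j) '' Set.Iio t₀ ⊆
      (Mat n).closure (base E (P.hblk E t₀) ∪ P.Pref E (P.hblk E t₀)) := by
  rintro q (hq | ⟨j, hj, rfl⟩)
  · exact (Mat n).subset_closure _ (by simp) (Or.inl hq)
  · have hjt : j < t₀ := hj
    rcases (P.hblk_mono E hjt.le).lt_or_eq with hlt | heq
    · exact (Mat n).subset_closure _ (by simp) (Or.inr ⟨j, ⟨lt_trans hjt ht₀, hlt⟩, rfl⟩)
    · have := P.gen_mem_closure E j (lt_trans hjt ht₀)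
      rwa [heq] at this

/-! ## One adversary round -/

/-- **One adversary round.**  With two cells to spare, the generic output `e` of `E` is a new cell, and
for the block index `v₀` of the first round `t₀ < T` killed by identifying `e`: for every block index
`v ≤ v₀` both measures do not increase from `E` to `insert e E` (each side measured with its own
blocks), and the measure of the speaker of block `v₀` strictly drops. -/
theorem round (E : Finset (Cell n)) {e₀ : Cell n} (he₀ : e₀ ∉ E) (hroom : ∀ e, ∃ e₁, e₁ ∉ insert e E) :
    P.genOut E ∉ E ∧ ∃ t₀ < T,
      (∀ v ≤ P.hblk E t₀,
        (Mat n).eRk (Xall ∪ P.Pref (insert (P.genOut E) E) v) ≤ (Mat n).eRk (Xall ∪ P.Pref E v) ∧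
        (Mat n).eRk (BE (insert (P.genOut E) E) ∪ P.Pref (insert (P.genOut E) E) v) ≤
          (Mat n).eRk (BE E ∪ P.Pref E v)) ∧
      (Mat n).eRk (base (insert (P.genOut E) E) (P.hblk E t₀) ∪ P.Pref (insert (P.genOut E) E)
          (P.hblk E t₀))
        < (Mat n).eRk (base E (P.hblk E t₀) ∪ P.Pref E (P.hblk E t₀)) := by
  obtain ⟨tk, htk, hnot, hk1, hk2⟩ := P.zariski_step E he₀ hroom
  refine ⟨hnot, ?_⟩
  set e := P.genOut E with he
  set F := insert e E with hF
  have hEF : E ⊆ F := Finset.subset_insert e E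
  -- the first killed round
  have hex : ∃ t, t < T ∧ P.gen E t ≠ 0 ∧ subst F (P.gen E t) = 0 := ⟨tk, htk, hk1, hk2⟩
  let t₀ := Nat.find hex
  obtain ⟨ht₀T, hne, hkilled⟩ : t₀ < T ∧ P.gen E t₀ ≠ 0 ∧ subst F (P.gen E t₀) = 0 := Nat.find_spec hex
  have hmin : ∀ j < t₀, ¬ (P.gen E j ≠ 0 ∧ subst F (P.gen E j) = 0) := by
    intro j hj hk
    exact Nat.find_min hex hj ⟨lt_trans hj ht₀T, hk⟩
  -- specialisation: the runs, speakers and blocks agree up to `t₀`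
  have hspec : ∀ j ≤ t₀, P.gen F j = subst F (P.gen E j) := fun j hj =>
    P.gen_eq_subst_gen_of_not_killed hEF j (fun j' hj' => hmin j' (lt_of_lt_of_le hj' hj))
  have hown : ∀ j ≤ t₀, P.gOwner F j = P.gOwner E j := P.gOwner_eq_of_not_killed hEF t₀ hmin
  have hblkeq : ∀ j ≤ t₀, P.hblk F j = P.hblk E j := fun j hj =>
    P.hblk_eq_of_gOwner_eq (fun j' hj' => hown j' (hj'.trans hj))
  -- rounds of `F`-blocks below `v ≤ hblk E t₀` are rounds `< t₀`
  have hFlt : ∀ {v j : ℕ}, v ≤ P.hblk E t₀ → P.hblk F j < v → j < t₀ := by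
    intro v j hv hjv
    by_contra hle
    have h1 : P.hblk F t₀ ≤ P.hblk F j := P.hblk_mono F (not_lt.mp hle)
    rw [hblkeq t₀ le_rfl] at h1
    omega
  have hElt : ∀ {v j : ℕ}, v ≤ P.hblk E t₀ → P.hblk E j < v → j < t₀ := fun hv hjv =>
    P.lt_of_hblk_lt E (lt_of_lt_of_le hjv hv)
  have hPref : ∀ v ≤ P.hblk E t₀, P.Pref F v = subst F '' P.Pref E v := by
    intro v hv
    ext q
    simp only [Pref, Set.mem_image, Set.mem_setOf_eq]
    constructor
    · rintro ⟨j, ⟨hjT, hjv⟩, rfl⟩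
      have hjt : j < t₀ := hFlt hv hjv
      refine ⟨P.gen E j, ⟨j, ⟨hjT, ?_⟩, rfl⟩, (hspec j hjt.le).symm⟩
      rwa [hblkeq j hjt.le] at hjv
    · rintro ⟨_, ⟨j, ⟨hjT, hjv⟩, rfl⟩, rfl⟩
      have hjt : j < t₀ := hElt hv hjv
      refine ⟨j, ⟨hjT, ?_⟩, hspec j hjt.le⟩
      rwa [hblkeq j hjt.le]
  refine ⟨t₀, ht₀T, ?_, ?_⟩
  · intro v hv
    constructor
    · have h : (Xall ∪ P.Pref F v : Set (R n)) = subst F '' (Xall ∪ P.Pref E v) := by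
        rw [Set.image_union, image_subst_Xall, hPref v hv]
      rw [h]
      exact eRk_image_le (subst F) _
    · have h : (BE F ∪ P.Pref F v : Set (R n)) = subst F '' (BE E ∪ P.Pref E v) := by
        rw [Set.image_union, image_subst_BE hEF, hPref v hv]
      rw [h]
      exact eRk_image_le (subst F) _
  · -- the strict drop at `v₀ = hblk E t₀`
    set S : Set (R n) := (fun j => P.gen E j) '' Set.Iio t₀ with hS
    have hSfin : S.Finite := (Set.finite_Iio t₀).image _
    have hQ : P.gen E t₀ ∈ Algebra.adjoin ℂ (base E (P.hblk E t₀) ∪ S) := P.gen_mem_adjoin_round E t₀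
    have hlt := eRk_image_lt (subst F) ((base_finite E _).union hSfin) hQ hne hkilled
    have hS' : subst F '' S = (fun j => P.gen F j) '' Set.Iio t₀ := by
      ext q
      simp only [hS, Set.mem_image, Set.mem_Iio]
      constructor
      · rintro ⟨_, ⟨j, hj, rfl⟩, rfl⟩; exact ⟨j, hj, hspec j hj.le⟩
      · rintro ⟨j, hj, rfl⟩; exact ⟨P.gen E j, ⟨j, hj, rfl⟩, (hspec j hj.le).symm⟩
    rw [Set.image_union, image_subst_base hEF, hS'] at hlt
    -- compare with the prefixes
    have hup : (Mat n).eRk (base E (P.hblk E t₀) ∪ S) ≤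
        (Mat n).eRk (base E (P.hblk E t₀) ∪ P.Pref E (P.hblk E t₀)) := by
      have h := (Mat n).eRk_mono (P.image_Iio_subset_closure E ht₀T)
      rwa [Matroid.eRk_closure_eq] at h
    have hdown : (Mat n).eRk (base F (P.hblk E t₀) ∪ P.Pref F (P.hblk E t₀)) ≤
        (Mat n).eRk (base F (P.hblk E t₀) ∪ (fun j => P.gen F j) '' Set.Iio t₀) := by
      apply (Mat n).eRk_mono
      rintro q (hq | ⟨j, ⟨hjT, hjv⟩, rfl⟩)
      · exact Or.inl hq
      · exact Or.inr ⟨j, hFlt le_rfl hjv, rfl⟩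
    exact lt_of_le_of_lt hdown (lt_of_lt_of_le hlt hup)

end HProtocol

end

end Summit.ValiantsHypothesis.ValiantsHypothesis.Theorems.AlgebraicKWGames.OneAlt
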